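import Summits.MatrixMultiplication.MatrixMultiplication.Theorems.ObstructionDescentTraceDiagramsBlind
import Literature.Computability.AlgebraicComplexity.TensorRestrictionRank

set_option linter.dupNamespace false

/-!
# The degree axis and the trace-identity asides are NECESSARY: `S ⟺ REQ ⟹ E ⟹ E_stab`
(decomp-mm · lens 3 · gen 19; route `route-MatrixMultiplication-ObstructionDescent`)

Kernel certificates (0 sorry) for the NEC tags of the route dossier, until now recorded only at sketch level
(«Gen8.noPolyDegreeObstruction_of_summit», «rankEventuallyQuadratic_iff»):

* `rankEventuallyQuadratic_iff_summit` — the route's ONE EQUIV layer (support item `RankEventuallyQuadratic`,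
  `stmt-MatrixMultiplication-29039`): `(∀ τ > 2, R(⟨n,n,n⟩) ≤ n^τ eventually) ⟺ ω(ℂ) = 2`
  [Blaser2013, §5; BurgisserClausenShokrollahi1997, §15.5 (15.11)].
* `noPolyDegreeObstruction_of_summit` — **`S ⟹ E`**: if `ω = 2` then at every cell of the degree axis `⟨n,n,n⟩` itself has
  rank `≤ n^τ ≤ m`, so every corner equation of border-rank type vanishes at it (any degree): the crux
  `NoPolyDegreeObstruction` (`stmt-MatrixMultiplication-30889`) is NECESSARY for the summit.
* `stableTraceIdentitiesBlind_of_summit` — **`S ⟹ E_stab`**: the aside `StableTraceIdentitiesBlind`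
  (`stmt-MatrixMultiplication-27205`) is NECESSARY for the summit.

[cite: Blaser2013, §5; BurgisserClausenShokrollahi1997, §15.5; LandsbergGCT2017, §8.3.2 (p. 226)]
-/

noncomputable section

open scoped BigOperators
open Finset Filter

namespace Summit.MatrixMultiplication.MatrixMultiplication.Theorems.ObstructionDescentDegreeAxisNecessary

open Literature.Computability.AlgebraicComplexity (tensorRank matMulTensor omega omega_two_le admissibleExponents
  admissibleExponents_bddBelow exists_tensorRank_matMulTensor_le_rpow)
open Summit.MatrixMultiplication.MatrixMultiplication.Theses.ObstructionDescent
  (NoPolyDegreeObstruction RankEventuallyQuadratic StableTraceIdentitiesBlind)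
open Summit.MatrixMultiplication.MatrixMultiplication.Theorems.ObstructionDescentCornerEquations
  (noPolyDegreeObstruction_iff_corner mem_rankVanishing)
open Summit.MatrixMultiplication.MatrixMultiplication.Theorems.ObstructionDescentTraceDiagramsBlind
  (stableTraceIdentitiesBlind_of_noPolyDegreeObstruction)

/-- `REQ ⟹ S`: eventual rank bounds `R(⟨n,n,n⟩) ≤ n^τ` for every `τ > 2` give `ω(ℂ) ≤ 2`, hence `= 2`.
[cite: Blaser2013, §5] -/
theorem summit_of_rankEventuallyQuadratic (h : RankEventuallyQuadratic) : _root_.MatrixMultiplication := by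
  refine MatrixMultiplication_iff.2 (le_antisymm ?_ (omega_two_le ℂ))
  refine le_of_forall_pos_le_add fun ε hε => ?_
  obtain ⟨n₀, hn₀⟩ := h (2 + ε) (by linarith)
  refine csInf_le (admissibleExponents_bddBelow ℂ) ?_
  refine Asymptotics.IsBigO.of_bound 1 ?_
  filter_upwards [Filter.eventually_ge_atTop n₀] with n hn
  rw [one_mul, Real.norm_of_nonneg (Nat.cast_nonneg _),
    Real.norm_of_nonneg (Real.rpow_nonneg (Nat.cast_nonneg _) _)]
  exact hn₀ n hn

/-- `S ⟹ REQ`: if `ω(ℂ) = 2` then for every `τ > 2`, `R(⟨n,n,n⟩) ≤ C·n^{(2+τ)/2} ≤ n^τ` for all large `n`.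
[cite: BurgisserClausenShokrollahi1997, §15.5 (proof of (15.11)); Blaser2013, §5] -/
theorem rankEventuallyQuadratic_of_summit (hS : _root_.MatrixMultiplication) : RankEventuallyQuadratic := by
  have hω : omega ℂ = 2 := MatrixMultiplication_iff.1 hS
  intro τ hτ
  have hδ : 0 < (τ - 2) / 2 := by linarith
  obtain ⟨C, hC, hCb⟩ := exists_tensorRank_matMulTensor_le_rpow ℂ hδ
  -- `C ≤ n ^ ((τ - 2)/2)` eventually
  have hev : ∀ᶠ n : ℕ in atTop, C ≤ (n : ℝ) ^ ((τ - 2) / 2) :=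
    ((tendsto_rpow_atTop hδ).comp tendsto_natCast_atTop_atTop).eventually_ge_atTop C
  obtain ⟨n₁, hn₁⟩ := eventually_atTop.1 hev
  refine ⟨max n₁ 1, fun n hn => ?_⟩
  have hn1 : 1 ≤ n := le_trans (le_max_right _ _) hn
  have hnn₁ : n₁ ≤ n := le_trans (le_max_left _ _) hn
  have hnpos : (0 : ℝ) < n := by exact_mod_cast hn1
  calc (tensorRank (matMulTensor ℂ n n n) : ℝ) ≤ C * (n : ℝ) ^ (omega ℂ + (τ - 2) / 2) := hCb n hn1
    _ ≤ (n : ℝ) ^ ((τ - 2) / 2) * (n : ℝ) ^ (omega ℂ + (τ - 2) / 2) :=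
        mul_le_mul_of_nonneg_right (hn₁ n hnn₁) (Real.rpow_nonneg hnpos.le _)
    _ = (n : ℝ) ^ τ := by
        rw [← Real.rpow_add hnpos, hω]
        congr 1
        ring

/-- THE ONE EQUIV LAYER of the route, in the kernel: `RankEventuallyQuadratic ⟺ ω(ℂ) = 2`.
[cite: Blaser2013, §5; BurgisserClausenShokrollahi1997, §15.5] -/
theorem rankEventuallyQuadratic_iff_summit : RankEventuallyQuadratic ↔ _root_.MatrixMultiplication :=
  ⟨summit_of_rankEventuallyQuadratic, rankEventuallyQuadratic_of_summit⟩

/-- `REQ ⟹ E`: at a cell (`n ≥ n₀`, `n² ≤ m`, `n^τ ≤ m`) the tensor `⟨n,n,n⟩` has rank `≤ n^τ ≤ m`, so every corner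
equation vanishing on the tensors of rank `≤ m` vanishes at it — whatever its degree. [cite: LandsbergGCT2017, §8.3.2 (p. 226)] -/
theorem noPolyDegreeObstruction_of_rankEventuallyQuadratic (h : RankEventuallyQuadratic) :
    NoPolyDegreeObstruction := by
  refine noPolyDegreeObstruction_iff_corner.2 fun c τ hτ => ?_
  obtain ⟨n₀, hn₀⟩ := h τ hτ
  refine ⟨n₀, fun n m hn _hnm hτm f _hdeg hf => ?_⟩
  have hR : (tensorRank (matMulTensor ℂ n n n) : ℝ) ≤ (m : ℝ) := (hn₀ n hn).trans hτm
  exact mem_rankVanishing.1 hf (matMulTensor ℂ n n n) (by exact_mod_cast hR)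

/-- **`S ⟹ E`**: the crux `NoPolyDegreeObstruction` is NECESSARY for `ω(ℂ) = 2`. [cite: LandsbergGCT2017, §8.3.2 (p. 226)] -/
theorem noPolyDegreeObstruction_of_summit (hS : _root_.MatrixMultiplication) : NoPolyDegreeObstruction :=
  noPolyDegreeObstruction_of_rankEventuallyQuadratic (rankEventuallyQuadratic_of_summit hS)

/-- **`S ⟹ E_stab`**: the aside `StableTraceIdentitiesBlind` is NECESSARY for `ω(ℂ) = 2`.
[cite: LandsbergGCT2017, Prop. 4.1.3.1, §8.3.2 (p. 226)] -/
theorem stableTraceIdentitiesBlind_of_summit (hS : _root_.MatrixMultiplication) : StableTraceIdentitiesBlind :=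
  stableTraceIdentitiesBlind_of_noPolyDegreeObstruction (noPolyDegreeObstruction_of_summit hS)

end Summit.MatrixMultiplication.MatrixMultiplication.Theorems.ObstructionDescentDegreeAxisNecessary
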